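import Summits.CriticalPhenomena.PercolationContinuityZ3.Theorems.PercNearOneGluingNoHeavyLowerTailFrontierDecRowsClusterBHK3Key
import HarnessLib

/-!
# Conjecture G⁺ (`ClusterBHK3Pos`) — the SANDWICH: the typed increasing triple has `E₃ ≤ 0` (proved), and an
# exact envelope identity for the conjectured decreasing triple

Support file (prover prim-ineq-prove-3 gen 11; `--supports stmt-CriticalPhenomena-4575`).  No sorries, no named facts, no
`native_decide`.

Setting (as in `…FrontierDecRowsClusterBHK3Defs`): Bernoulli bond percolation `μ = prodBernoulli w` on a finite vertex type,
terminal sets `S, T`, the separation `D = {S ↮ T}` (decreasing), and two events `A`, `B` that are increasing functions of the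
open edge clusters `C_S`, `C_T` ALONE ("cluster-monotone").  Write `U = Dᶜ = {S ↔ T}`, `m = μ(D)`, and
`c_A := μ(D)μ(A) − μ(D ∩ A) = Cov(1_U, 1_A) ≥ 0`, `c_B` likewise (Harris), `Cov(A,B) := μ(A ∩ B) − μ(A)μ(B) ≥ 0` (Harris),
`Δ* := μ(D∩A)μ(D∩B) − μ(D)μ(D∩A∩B) ≥ 0` (the BHK two-cluster deficit, tree `setTwoClusterExchange`).

RESULTS.
* `sandwich_alg_eq` — the exact identity `m · E₃(D, A, B) = −2Δ* − m²·Cov(A,B) − μ(D∩B)·c_A − μ(D∩A)·c_B` (pure algebra),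
  `bhk_deficit_nonneg` (`Δ* ≥ 0`, from `setTwoClusterExchange`), `harris_three` (the three Harris facts);
* `mul_sahiE3_sep_incr_le`, `sahiE3_sep_incr_nonpos` — hence **`E₃({S ↮ T}, A, B) ≤ 0`** for the INCREASING typed triple;
* `sahiE3_compl₂`, `sahiE3_compl₁` — one-slot complement rules `E₃(X, Yᶜ, Z) = Cov(X,Z) − E₃(X,Y,Z)`,
  `E₃(Xᶜ, Y, Z) = Cov(Y,Z) − E₃(X,Y,Z)` (inclusion–exclusion, any probability measure);
* `cov_le_sahiE3_conn_incr`, `sahiE3_conn_incr_nonneg` — **`0 ≤ Cov(A,B) ≤ E₃({S ↔ T}, A, B)`**: Sahi/Kahn positivity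
  (Kahn's Conj. 5 shape) for EVERY increasing typed triple `({S ↔ T}, A, B)`, with the quantitative lower bound `Cov(A,B)`;
* `mul_sahiE3_sep_compl_eq`, `mul_sahiE3_sep_compl_le` — for the DECREASING triple of Conjecture G⁺ the exact identity
  `m · E₃(D, Aᶜ, Bᶜ) = μ(D ∖ B)·c_A + μ(D ∖ A)·c_B − m²·Cov(A,B) − 2Δ*`
  and hence the unconditional UPPER envelope `m · E₃(D, Aᶜ, Bᶜ) ≤ μ(D ∖ B)·c_A + μ(D ∖ A)·c_B − m²·Cov(A,B)`.

So `ClusterBHK3Pos` (`0 ≤ E₃(D, Aᶜ, Bᶜ)`, OPEN) is EQUIVALENT to `2Δ* + m²·Cov(A,B) ≤ μ(D ∖ B)·c_A + μ(D ∖ A)·c_B` ("twice the BHK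
deficit plus the damped covariance of the two cluster events is paid by the two Harris covariances with the connection"), and it
IMPLIES the weaker, deficit-free "covariance triangle inequality" `μ(D)²·Cov(A,B) ≤ μ(D ∖ B)·Cov(U,A) + μ(D ∖ A)·Cov(U,B)` (CT), itself
open (0 violations in 4 320 exact typed cases, seat probe lab/ct_probe.py; the natural sufficient splittings of CT fail).  Together
with the lower half this is the sandwich `Cov(A,B) ≤ E₃(U, A, B) ≤(?) Cov(A,B) + c_A + c_B` for the increasing triple.
-/

noncomputable section

namespace Summit.CriticalPhenomena.PercolationContinuityZ3.Theorems.FrontierDecRows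

open MeasureTheory
open Literature.Probability.Percolation Literature.Probability.LatticeModels

/-! ### One-slot complement rules for `sahiE3` (any probability measure) -/

section Compl

variable {Ω : Type*} [MeasurableSpace Ω] (μ : Measure Ω) [IsProbabilityMeasure μ]

/-- `μ(X ∩ Yᶜ) = μ(X) − μ(X ∩ Y)`. [folklore] -/
theorem measureReal_inter_compl_eq_sub {X Y : Set Ω} (hY : MeasurableSet Y) :
    μ.real (X ∩ Yᶜ) = μ.real X - μ.real (X ∩ Y) := by
  have h := measureReal_inter_add_sdiff (μ := μ) (s := X) hY
  rw [Set.sdiff_eq] at h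
  linarith

/-- **Complement in the middle slot**: `E₃(X, Yᶜ, Z) = Cov(X, Z) − E₃(X, Y, Z)` for a probability measure.
(Inclusion–exclusion; `E₃` is affine in each slot.) [folklore; cite: LiebSahi2021, eq. (2.1) (arXiv p. 5)] -/
theorem sahiE3_compl₂ {X Y Z : Set Ω} (hY : MeasurableSet Y) :
    sahiE3 μ X Yᶜ Z = (μ.real (X ∩ Z) - μ.real X * μ.real Z) - sahiE3 μ X Y Z := by
  have h1 : μ.real Yᶜ = 1 - μ.real Y := probReal_compl_eq_one_sub hY
  have h2 : μ.real (X ∩ Yᶜ) = μ.real X - μ.real (X ∩ Y) := measureReal_inter_compl_eq_sub μ hY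
  have h3 : μ.real (Yᶜ ∩ Z) = μ.real Z - μ.real (Y ∩ Z) := by
    rw [Set.inter_comm Yᶜ Z, Set.inter_comm Y Z]
    exact measureReal_inter_compl_eq_sub μ hY
  have h4 : μ.real (X ∩ Yᶜ ∩ Z) = μ.real (X ∩ Z) - μ.real (X ∩ Y ∩ Z) := by
    rw [Set.inter_assoc, Set.inter_comm Yᶜ Z, ← Set.inter_assoc, Set.inter_assoc X Y Z, Set.inter_comm Y Z,
      ← Set.inter_assoc]
    exact measureReal_inter_compl_eq_sub μ hY
  simp only [sahiE3_def, h1, h2, h3, h4]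
  ring

/-- **Complement in the first slot**: `E₃(Xᶜ, Y, Z) = Cov(Y, Z) − E₃(X, Y, Z)` for a probability measure. [folklore] -/
theorem sahiE3_compl₁ {X Y Z : Set Ω} (hX : MeasurableSet X) :
    sahiE3 μ Xᶜ Y Z = (μ.real (Y ∩ Z) - μ.real Y * μ.real Z) - sahiE3 μ X Y Z := by
  rw [sahiE3_comm₁₂ μ Xᶜ Y Z, sahiE3_compl₂ μ hX, sahiE3_comm₁₂ μ Y X Z]

/-- **Complement in the last slot**: `E₃(X, Y, Zᶜ) = Cov(X, Y) − E₃(X, Y, Z)` for a probability measure. [folklore] -/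
theorem sahiE3_compl₃ {X Y Z : Set Ω} (hZ : MeasurableSet Z) :
    sahiE3 μ X Y Zᶜ = (μ.real (X ∩ Y) - μ.real X * μ.real Y) - sahiE3 μ X Y Z := by
  rw [sahiE3_comm₂₃ μ X Y Zᶜ, sahiE3_compl₂ μ hZ, sahiE3_comm₂₃ μ X Z Y]

end Compl

/-! ### The algebra of the sandwich -/

/-- **The identity behind the sandwich** (pure algebra).  With `m = μ(D)`, `α = μ(A)`, `β = μ(B)`, `dab = μ(D∩A∩B)`,
`da = μ(D∩A)`, `db = μ(D∩B)`, `ab = μ(A∩B)`: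
`m·E₃(D,A,B) = −2(da·db − m·dab) − [m²(ab − αβ) + db(mα − da) + da(mβ − db)]`. [this work] -/
theorem sandwich_alg_eq (m α β dab da db ab : ℝ) :
    m * (2 * dab + m * α * β - (m * ab + α * db + β * da)) =
      -2 * (da * db - m * dab) - (m * m * (ab - α * β) + db * (m * α - da) + da * (m * β - db)) := by
  ring

variable {V : Type*} [Fintype V]

omit [Fintype V] in
/-- The connection event `{S ↔ T}` is the complement of the separation `{S ↮ T}`. [folklore] -/
theorem setOf_exists_reachable_eq_compl (S T : Set V) :
    {ω : BondConfig V | ∃ s ∈ S, ∃ t ∈ T, (openGraph ω).Reachable s t} =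
      {ω : BondConfig V | ∀ s ∈ S, ∀ t ∈ T, ¬ (openGraph ω).Reachable s t}ᶜ := by
  ext ω
  simp only [Set.mem_setOf_eq, Set.mem_compl_iff, not_forall, not_not, exists_prop]

section Main

variable (w : Sym2 V → unitInterval) (S T : Set V) {A B : Set (BondConfig V)}
  (hA : ∀ ⦃ω ω' : BondConfig V⦄, (⋃ s ∈ S, openEdgeCluster ω s) ⊆ (⋃ s ∈ S, openEdgeCluster ω' s) → ω ∈ A → ω' ∈ A)
  (hB : ∀ ⦃ω ω' : BondConfig V⦄, (⋃ t ∈ T, openEdgeCluster ω t) ⊆ (⋃ t ∈ T, openEdgeCluster ω' t) → ω ∈ B → ω' ∈ B)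

include hA hB

/-- **BHK deficit is nonnegative** (the two-set exchange, tree `setTwoClusterExchange`, with `A₂ = B₁ = univ`):
`μ(D) · μ(D ∩ A ∩ B) ≤ μ(D ∩ A) · μ(D ∩ B)` for `A` increasing in `C_S` and `B` increasing in `C_T`.
[cite: VandenbergHaggstromKahn2005, Thm. 1.5 / Thm. 2.1 at q = 1 (p. 9)] -/
theorem bhk_deficit_nonneg :
    (prodBernoulli w).real {ω : BondConfig V | ∀ s ∈ S, ∀ t ∈ T, ¬ (openGraph ω).Reachable s t} *
        (prodBernoulli w).real ({ω : BondConfig V | ∀ s ∈ S, ∀ t ∈ T, ¬ (openGraph ω).Reachable s t} ∩ A ∩ B) ≤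
      (prodBernoulli w).real ({ω : BondConfig V | ∀ s ∈ S, ∀ t ∈ T, ¬ (openGraph ω).Reachable s t} ∩ A) *
        (prodBernoulli w).real ({ω : BondConfig V | ∀ s ∈ S, ∀ t ∈ T, ¬ (openGraph ω).Reachable s t} ∩ B) := by
  have h := setTwoClusterExchange w S T (A₁ := A) (A₂ := Set.univ) (B₁ := B) (B₂ := Set.univ)
    (fun ω ω' hS _ hω => hA hS hω) (fun _ _ _ _ _ => Set.mem_univ _)
    (fun ω ω' _ hT hω => hB hT hω) (fun _ _ _ _ _ => Set.mem_univ _)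
  simp only [Set.inter_univ] at h
  rw [← Set.inter_assoc] at h
  linarith [h]

/-- **Quantitative form**: `m·E₃(D, A, B) ≤ −[m²·Cov(A,B) + μ(D∩B)·c_A + μ(D∩A)·c_B]` where
`c_A = μ(D)μ(A) − μ(D∩A) ≥ 0`, `c_B ≥ 0`, `Cov(A,B) ≥ 0`; in particular the right-hand side is `≤ 0`. [this work] -/
theorem mul_sahiE3_sep_incr_le :
    (prodBernoulli w).real {ω : BondConfig V | ∀ s ∈ S, ∀ t ∈ T, ¬ (openGraph ω).Reachable s t} *
        sahiE3 (prodBernoulli w) {ω : BondConfig V | ∀ s ∈ S, ∀ t ∈ T, ¬ (openGraph ω).Reachable s t} A B ≤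
      -((prodBernoulli w).real {ω : BondConfig V | ∀ s ∈ S, ∀ t ∈ T, ¬ (openGraph ω).Reachable s t} *
            (prodBernoulli w).real {ω : BondConfig V | ∀ s ∈ S, ∀ t ∈ T, ¬ (openGraph ω).Reachable s t} *
            ((prodBernoulli w).real (A ∩ B) - (prodBernoulli w).real A * (prodBernoulli w).real B) +
          (prodBernoulli w).real ({ω : BondConfig V | ∀ s ∈ S, ∀ t ∈ T, ¬ (openGraph ω).Reachable s t} ∩ B) *
            ((prodBernoulli w).real {ω : BondConfig V | ∀ s ∈ S, ∀ t ∈ T, ¬ (openGraph ω).Reachable s t} *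
                (prodBernoulli w).real A -
              (prodBernoulli w).real ({ω : BondConfig V | ∀ s ∈ S, ∀ t ∈ T, ¬ (openGraph ω).Reachable s t} ∩ A)) +
          (prodBernoulli w).real ({ω : BondConfig V | ∀ s ∈ S, ∀ t ∈ T, ¬ (openGraph ω).Reachable s t} ∩ A) *
            ((prodBernoulli w).real {ω : BondConfig V | ∀ s ∈ S, ∀ t ∈ T, ¬ (openGraph ω).Reachable s t} *
                (prodBernoulli w).real B -
              (prodBernoulli w).real ({ω : BondConfig V | ∀ s ∈ S, ∀ t ∈ T, ¬ (openGraph ω).Reachable s t} ∩ B))) := by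
  set μ := prodBernoulli w with hμ
  set D := {ω : BondConfig V | ∀ s ∈ S, ∀ t ∈ T, ¬ (openGraph ω).Reachable s t} with hD
  have hdef := bhk_deficit_nonneg w S T hA hB
  rw [← hμ, ← hD] at hdef
  have key := sandwich_alg_eq (μ.real D) (μ.real A) (μ.real B) (μ.real (D ∩ A ∩ B)) (μ.real (D ∩ A))
    (μ.real (D ∩ B)) (μ.real (A ∩ B))
  rw [sahiE3_def, key]
  linarith

/-- The three Harris facts used: `Cov(A,B) ≥ 0`, `c_A = μ(D)μ(A) − μ(D∩A) ≥ 0`, `c_B ≥ 0`. [folklore; Harris 1960] -/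
theorem harris_three :
    (prodBernoulli w).real A * (prodBernoulli w).real B ≤ (prodBernoulli w).real (A ∩ B) ∧
      (prodBernoulli w).real ({ω : BondConfig V | ∀ s ∈ S, ∀ t ∈ T, ¬ (openGraph ω).Reachable s t} ∩ A) ≤
          (prodBernoulli w).real {ω : BondConfig V | ∀ s ∈ S, ∀ t ∈ T, ¬ (openGraph ω).Reachable s t} *
            (prodBernoulli w).real A ∧
        (prodBernoulli w).real ({ω : BondConfig V | ∀ s ∈ S, ∀ t ∈ T, ¬ (openGraph ω).Reachable s t} ∩ B) ≤
          (prodBernoulli w).real {ω : BondConfig V | ∀ s ∈ S, ∀ t ∈ T, ¬ (openGraph ω).Reachable s t} *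
            (prodBernoulli w).real B := by
  have hAu : IsUpperSet A := isUpperSet_of_clusterMono S hA
  have hBu : IsUpperSet B := isUpperSet_of_clusterMono T hB
  have hDl : IsLowerSet {ω : BondConfig V | ∀ s ∈ S, ∀ t ∈ T, ¬ (openGraph ω).Reachable s t} :=
    ClusterMarkovE3.isLowerSet_sepEv S T
  refine ⟨prodBernoulli_harris w hAu hBu MeasurableSet.of_discrete MeasurableSet.of_discrete, ?_, ?_⟩
  · have h := prodBernoulli_harris_upper_lower w hAu hDl MeasurableSet.of_discrete MeasurableSet.of_discrete
    rw [Set.inter_comm] at h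
    linarith
  · have h := prodBernoulli_harris_upper_lower w hBu hDl MeasurableSet.of_discrete MeasurableSet.of_discrete
    rw [Set.inter_comm] at h
    linarith

/-- **Lower half of the G-sandwich: the increasing typed triple has `E₃ ≤ 0`.**  For `A` an increasing function of `C_S`
alone and `B` an increasing function of `C_T` alone, `E₃({S ↮ T}, A, B) ≤ 0` on every finite weighted graph.  (BHK's two-set
exchange bounds `μ(D∩A∩B)`, Harris does the rest; see the module docstring.) [this work] -/
theorem sahiE3_sep_incr_nonpos :
    sahiE3 (prodBernoulli w) {ω : BondConfig V | ∀ s ∈ S, ∀ t ∈ T, ¬ (openGraph ω).Reachable s t} A B ≤ 0 := by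
  have hle := mul_sahiE3_sep_incr_le w S T hA hB
  obtain ⟨h2, h3, h4⟩ := harris_three w S T hA hB
  set μ := prodBernoulli w with hμ
  set D := {ω : BondConfig V | ∀ s ∈ S, ∀ t ∈ T, ¬ (openGraph ω).Reachable s t} with hD
  have hm0 : 0 ≤ μ.real D := measureReal_nonneg
  have hda0 : 0 ≤ μ.real (D ∩ A) := measureReal_nonneg
  have hdb0 : 0 ≤ μ.real (D ∩ B) := measureReal_nonneg
  rcases hm0.eq_or_lt with hm | hm
  · rw [sahiE3_comm₁₂, sahiE3_comm₂₃, sahiE3_eq_zero_of_measureReal_eq_zero μ A B D hm.symm]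
  · have hprod : μ.real D * sahiE3 μ D A B ≤ 0 := by
      have t1 : 0 ≤ μ.real D * μ.real D * (μ.real (A ∩ B) - μ.real A * μ.real B) :=
        mul_nonneg (mul_nonneg hm0 hm0) (by linarith)
      have t2 : 0 ≤ μ.real (D ∩ B) * (μ.real D * μ.real A - μ.real (D ∩ A)) := mul_nonneg hdb0 (by linarith)
      have t3 : 0 ≤ μ.real (D ∩ A) * (μ.real D * μ.real B - μ.real (D ∩ B)) := mul_nonneg hda0 (by linarith)
      linarith
    have h0 : μ.real D * sahiE3 μ D A B ≤ μ.real D * 0 := by simpa using hprod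
    exact le_of_mul_le_mul_left h0 hm

/-- **Sahi positivity with a margin for the increasing typed triple** `({S ↔ T}, A, B)`:
`Cov(A, B) ≤ E₃({S ↔ T}, A, B)`, where `{S ↔ T} = {S ↮ T}ᶜ`. [this work] -/
theorem cov_le_sahiE3_conn_incr :
    (prodBernoulli w).real (A ∩ B) - (prodBernoulli w).real A * (prodBernoulli w).real B ≤
      sahiE3 (prodBernoulli w) {ω : BondConfig V | ∃ s ∈ S, ∃ t ∈ T, (openGraph ω).Reachable s t} A B := by
  rw [setOf_exists_reachable_eq_compl, sahiE3_compl₁ (prodBernoulli w) MeasurableSet.of_discrete]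
  linarith [sahiE3_sep_incr_nonpos w S T hA hB]

/-- **Kahn/Sahi `E₃ ≥ 0` for every increasing typed triple** `({S ↔ T}, A, B)` (`A` an increasing function of `C_S`, `B` of
`C_T`): an unconditional instance family of [Kahn2022, Conj. 5] on finite weighted graphs. [this work] -/
theorem sahiE3_conn_incr_nonneg :
    0 ≤ sahiE3 (prodBernoulli w) {ω : BondConfig V | ∃ s ∈ S, ∃ t ∈ T, (openGraph ω).Reachable s t} A B := by
  have h := cov_le_sahiE3_conn_incr w S T hA hB
  obtain ⟨h2, -, -⟩ := harris_three w S T hA hB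
  linarith

omit hA hB in
/-- **The G⁺ envelope identity.**  For the decreasing triple of `ClusterBHK3Pos`,
`m·E₃(D, Aᶜ, Bᶜ) = μ(D ∩ Bᶜ)·c_A + μ(D ∩ Aᶜ)·c_B − m²·Cov(A,B) − 2Δ*` with `c_A = mμ(A) − μ(D∩A)`, `c_B = mμ(B) − μ(D∩B)`,
`Δ* = μ(D∩A)μ(D∩B) − m·μ(D∩A∩B)` (`m = μ(D)`).  So `ClusterBHK3Pos ⟺ 2Δ* + m²Cov(A,B) ≤ μ(D∖B)c_A + μ(D∖A)c_B`. [this work] -/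
theorem mul_sahiE3_sep_compl_eq (A B : Set (BondConfig V)) :
    (prodBernoulli w).real {ω : BondConfig V | ∀ s ∈ S, ∀ t ∈ T, ¬ (openGraph ω).Reachable s t} *
        sahiE3 (prodBernoulli w) {ω : BondConfig V | ∀ s ∈ S, ∀ t ∈ T, ¬ (openGraph ω).Reachable s t} Aᶜ Bᶜ =
      (prodBernoulli w).real ({ω : BondConfig V | ∀ s ∈ S, ∀ t ∈ T, ¬ (openGraph ω).Reachable s t} ∩ Bᶜ) *
            ((prodBernoulli w).real {ω : BondConfig V | ∀ s ∈ S, ∀ t ∈ T, ¬ (openGraph ω).Reachable s t} *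
                (prodBernoulli w).real A -
              (prodBernoulli w).real ({ω : BondConfig V | ∀ s ∈ S, ∀ t ∈ T, ¬ (openGraph ω).Reachable s t} ∩ A)) +
          (prodBernoulli w).real ({ω : BondConfig V | ∀ s ∈ S, ∀ t ∈ T, ¬ (openGraph ω).Reachable s t} ∩ Aᶜ) *
            ((prodBernoulli w).real {ω : BondConfig V | ∀ s ∈ S, ∀ t ∈ T, ¬ (openGraph ω).Reachable s t} *
                (prodBernoulli w).real B -
              (prodBernoulli w).real ({ω : BondConfig V | ∀ s ∈ S, ∀ t ∈ T, ¬ (openGraph ω).Reachable s t} ∩ B)) -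
        (prodBernoulli w).real {ω : BondConfig V | ∀ s ∈ S, ∀ t ∈ T, ¬ (openGraph ω).Reachable s t} *
            (prodBernoulli w).real {ω : BondConfig V | ∀ s ∈ S, ∀ t ∈ T, ¬ (openGraph ω).Reachable s t} *
            ((prodBernoulli w).real (A ∩ B) - (prodBernoulli w).real A * (prodBernoulli w).real B) -
        2 * ((prodBernoulli w).real ({ω : BondConfig V | ∀ s ∈ S, ∀ t ∈ T, ¬ (openGraph ω).Reachable s t} ∩ A) *
              (prodBernoulli w).real ({ω : BondConfig V | ∀ s ∈ S, ∀ t ∈ T, ¬ (openGraph ω).Reachable s t} ∩ B) -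
            (prodBernoulli w).real {ω : BondConfig V | ∀ s ∈ S, ∀ t ∈ T, ¬ (openGraph ω).Reachable s t} *
              (prodBernoulli w).real ({ω : BondConfig V | ∀ s ∈ S, ∀ t ∈ T, ¬ (openGraph ω).Reachable s t} ∩ A ∩ B)) := by
  set μ := prodBernoulli w with hμ
  set D := {ω : BondConfig V | ∀ s ∈ S, ∀ t ∈ T, ¬ (openGraph ω).Reachable s t} with hD
  have hAm : MeasurableSet A := MeasurableSet.of_discrete
  have hBm : MeasurableSet B := MeasurableSet.of_discrete
  rw [sahiE3_compl₂ μ hAm, sahiE3_compl₃ μ hBm, measureReal_inter_compl_eq_sub μ hAm,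
    measureReal_inter_compl_eq_sub μ hBm, probReal_compl_eq_one_sub hBm, sahiE3_def]
  ring

/-- **The unconditional upper envelope of Conjecture G⁺**: `m·E₃(D, Aᶜ, Bᶜ) ≤ μ(D ∩ Bᶜ)·c_A + μ(D ∩ Aᶜ)·c_B − m²·Cov(A,B)`
(drop `2Δ* ≥ 0`).  Read together with `ClusterBHK3Pos` (`0 ≤ E₃(D, Aᶜ, Bᶜ)`, open) this sandwiches the conjectured quantity, and shows
that G⁺ implies the "covariance triangle inequality" `μ(D)²Cov(A,B) ≤ μ(D∖B)Cov(U,A) + μ(D∖A)Cov(U,B)`, `U = {S ↔ T}`. [this work] -/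
theorem mul_sahiE3_sep_compl_le :
    (prodBernoulli w).real {ω : BondConfig V | ∀ s ∈ S, ∀ t ∈ T, ¬ (openGraph ω).Reachable s t} *
        sahiE3 (prodBernoulli w) {ω : BondConfig V | ∀ s ∈ S, ∀ t ∈ T, ¬ (openGraph ω).Reachable s t} Aᶜ Bᶜ ≤
      (prodBernoulli w).real ({ω : BondConfig V | ∀ s ∈ S, ∀ t ∈ T, ¬ (openGraph ω).Reachable s t} ∩ Bᶜ) *
            ((prodBernoulli w).real {ω : BondConfig V | ∀ s ∈ S, ∀ t ∈ T, ¬ (openGraph ω).Reachable s t} *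
                (prodBernoulli w).real A -
              (prodBernoulli w).real ({ω : BondConfig V | ∀ s ∈ S, ∀ t ∈ T, ¬ (openGraph ω).Reachable s t} ∩ A)) +
          (prodBernoulli w).real ({ω : BondConfig V | ∀ s ∈ S, ∀ t ∈ T, ¬ (openGraph ω).Reachable s t} ∩ Aᶜ) *
            ((prodBernoulli w).real {ω : BondConfig V | ∀ s ∈ S, ∀ t ∈ T, ¬ (openGraph ω).Reachable s t} *
                (prodBernoulli w).real B -
              (prodBernoulli w).real ({ω : BondConfig V | ∀ s ∈ S, ∀ t ∈ T, ¬ (openGraph ω).Reachable s t} ∩ B)) -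
        (prodBernoulli w).real {ω : BondConfig V | ∀ s ∈ S, ∀ t ∈ T, ¬ (openGraph ω).Reachable s t} *
            (prodBernoulli w).real {ω : BondConfig V | ∀ s ∈ S, ∀ t ∈ T, ¬ (openGraph ω).Reachable s t} *
            ((prodBernoulli w).real (A ∩ B) - (prodBernoulli w).real A * (prodBernoulli w).real B) := by
  have h := mul_sahiE3_sep_compl_eq w S T A B
  have hdef := bhk_deficit_nonneg w S T hA hB
  linarith

end Main

end Summit.CriticalPhenomena.PercolationContinuityZ3.Theorems.FrontierDecRows

end
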